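import Literature.NumberTheory.EllipticCurves.ModularFormsGamma0FreeModule
import HarnessLib

/-!
# `M(Γ) = ⊕ₖ M_k(Γ)` is a free module over `M(SL₂(ℤ)) = ℂ[E₄, E₆]` on at most `[SL₂(ℤ) : Γ]`
# homogeneous generators, for every finite-index level `Γ ∋ T, -1`
# (the level-general form of `ModularFormsGamma0FreeModule`)

`ModularFormsGamma0FreeModule` proved the structure theorem for `A = M(Γ₀(N))` as a graded module
over `R = M(SL₂(ℤ)) = ℂ[E₄, E₆]` — free on homogeneous generators `F_1, …, F_r` of even weights
`k_j ≥ 0`, `r ≤ μ = [SL₂(ℤ) : Γ₀(N)]` (`exists_isLevelOneBasis`) — by arguments that use the level only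
through (i) finite-dimensionality with Sturm's bound `dim M_k ≤ ⌊k[SL₂(ℤ):Γ]/12⌋ + 1` and
(ii) `-1 ∈ Γ₀(N)` (no odd weights). This file is the **verbatim generalisation to an arbitrary
subgroup `Γ ≤ SL₂(ℤ)` of finite index containing `T = (1 1; 0 1)` and `-1`** (hypotheses
`[Γ.FiniteIndex]`, `[Fact (T ∈ Γ)]`, `(hneg : -1 ∈ Γ)`), in the sub-namespace `Level` with the same
names: `Level.levelSpace Γ k = formSpace Γ k`, `Level.decomp`, `Level.gen`, `Level.GenIndex`,
`Level.exists_coeffs` (spanning), `Level.coeffs_eq_zero` (independence, graded Nakayama by hand via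
the division lemma `exists_eq_E6_mul_of_E4_mul_eq`), `Level.card_genBelow_le` (at most `[SL₂(ℤ) : Γ]`
generators of weight `≤ B`, from the injection `⊕_j R_{M-k_j} ↪ A_M` against Sturm),
`Level.IsLevelBasis Γ wt F` and **`Level.exists_isLevelBasis`**: a level-one basis of `M(Γ)` indexed by
`Fin r`, `r ≤ [SL₂(ℤ) : Γ]`, of even weights `≥ 0`.

The intended instance is `Γ = ±Γ₁(N)` (even-weight forms on `Γ₁(N)`), for which the rank input
`r ≥ [SL₂(ℤ) : ±Γ₁(N)]` is `ModularFormsGamma1ExplicitForms.charExplicitForm_indep_even`; with it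
the determinant / Serre-derivative / cusp-count arguments of `ModularFormsGamma0Rank`,
`ModularFormsGamma0Genus` and the bookkeeping of `ModularFormsGamma0Dimension` give the dimension of
`M_k(Γ₁(N))` in large even weights (the rank half of Eichler–Shimura for `Γ₁(N)`). Nothing beyond the
free-module structure is proved here; no named facts.

## References

* T. Gannon, *The theory of vector-valued modular forms for the modular group*, Contrib. Math.
  Comput. Sci. 8, Springer (2014), 247–286 (arXiv:1310.4458), Thm. 3.4(a), §3.5.
* C. Marks, G. Mason, *Structure of the module of vector-valued modular forms*, J. London Math.
  Soc. (2) 82 (2010), 32–48, Thm. 1.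
-/

noncomputable section

open UpperHalfPlane hiding I
open ModularForm Complex Matrix.SpecialLinearGroup Filter Asymptotics CongruenceSubgroup
  EisensteinSeries
open scoped MatrixGroups Real ModularForm Topology Manifold

namespace Literature.NumberTheory.EllipticCurves.ModularForms

section Level

namespace Level

variable (Γ : Subgroup SL(2, ℤ))

/-- The form space `A_k = M_k(Γ)` of a level `Γ ≤ SL₂(ℤ)`. [folklore] -/
abbrev levelSpace (k : ℤ) : Submodule ℂ (ℍ → ℂ) := formSpace Γ k

/-- `Γ ≤ SL₂(ℤ)` inside `GL(2, ℝ)`. [folklore] -/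
theorem level_le_SL : ((Γ : Subgroup SL(2, ℤ)) : Subgroup (GL (Fin 2) ℝ)) ≤ 𝒮ℒ := by
  rintro _ ⟨g, -, rfl⟩
  exact ⟨g, rfl⟩

variable [Γ.FiniteIndex] [hT : Fact (ModularGroup.T ∈ Γ)]

omit [Γ.FiniteIndex] in
/-- `1` is a strict period of a level containing `T`. [folklore] -/
theorem one_mem_strictPeriods : (1 : ℝ) ∈ (Γ : Subgroup (GL (Fin 2) ℝ)).strictPeriods := by
  rw [Subgroup.strictPeriods_eq_zmultiples_one_of_T_mem hT.out]
  exact AddSubgroup.mem_zmultiples (1 : ℝ)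

/-- **Sturm for the level `Γ`**: `M_k(Γ)` is finite-dimensional with
`dim M_k(Γ) ≤ ⌊k[SL₂(ℤ) : Γ]/12⌋ + 1` (tree `finiteDimensional_modularForm_and_finrank_le`,
`card_quotient_subgroupOf_eq_index`). [folklore] -/
theorem finiteDimensional_modularForm_level (k : ℤ) :
    FiniteDimensional ℂ (ModularForm Γ k) ∧
      Module.finrank ℂ (ModularForm Γ k) ≤ (k * Γ.index).toNat / 12 + 1 := by
  have := finiteDimensional_modularForm_and_finrank_le (𝒢 := Γ) (k := k) (one_mem_strictPeriods Γ)
  rwa [card_quotient_subgroupOf_eq_index] at this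

/-- `A_k` is finite-dimensional (Sturm). [folklore] -/
instance finiteDimensional_levelSpace (k : ℤ) : FiniteDimensional ℂ (levelSpace Γ k) :=
  haveI := (finiteDimensional_modularForm_level Γ k).1
  finiteDimensional_formSpace

/-- `dim A_k ≤ ⌊k[SL₂(ℤ) : Γ]/12⌋ + 1` (Sturm). [folklore] -/
theorem finrank_levelSpace_le (k : ℤ) :
    Module.finrank ℂ (levelSpace Γ k) ≤ (k * Γ.index).toNat / 12 + 1 := by
  rw [finrank_formSpace]
  exact (finiteDimensional_modularForm_level Γ k).2

omit hT in
/-- `R_w · A_k ⊆ A_{w+k}`. [folklore] -/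
theorem levelOne_mul_mem {w k : ℤ} {p f : ℍ → ℂ} (hp : p ∈ levelOneSpace w)
    (hf : f ∈ levelSpace Γ k) : p * f ∈ levelSpace Γ (w + k) :=
  mul_mem_formSpace (formSpace_mono (level_le_SL Γ) hp) hf

omit [Γ.FiniteIndex] hT in
/-- `A_k = 0` for odd `k` when `-1 ∈ Γ`. [folklore] -/
theorem levelSpace_eq_bot_of_odd (hneg : -1 ∈ Γ) {k : ℤ} (hk : Odd k) : levelSpace Γ k = ⊥ :=
  formSpace_eq_bot_of_odd ⟨-1, hneg, by ext; simp⟩ hk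

/-- The decomposable part `E₄ A_{k-4} + E₆ A_{k-6} ⊆ A_k`. [folklore] -/
def decomp (k : ℤ) : Submodule ℂ (ℍ → ℂ) :=
  (levelSpace Γ (k - 4)).map (LinearMap.mulLeft ℂ (⇑E₄ : ℍ → ℂ)) ⊔
    (levelSpace Γ (k - 6)).map (LinearMap.mulLeft ℂ (⇑E₆ : ℍ → ℂ))

omit [Γ.FiniteIndex] hT in
/-- Membership in `decomp`. [folklore] -/
theorem mem_decomp_iff {k : ℤ} {f : ℍ → ℂ} : f ∈ decomp Γ k ↔
    ∃ g ∈ levelSpace Γ (k - 4), ∃ h ∈ levelSpace Γ (k - 6), f = ⇑E₄ * g + ⇑E₆ * h := by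
  simp only [decomp, Submodule.mem_sup, Submodule.mem_map, LinearMap.mulLeft_apply]
  constructor
  · rintro ⟨_, ⟨g, hg, rfl⟩, _, ⟨h, hh, rfl⟩, rfl⟩
    exact ⟨g, hg, h, hh, rfl⟩
  · rintro ⟨g, hg, h, hh, rfl⟩
    exact ⟨_, ⟨g, hg, rfl⟩, _, ⟨h, hh, rfl⟩, rfl⟩

omit hT in
/-- `decomp Γ k ≤ A_k`. [folklore] -/
theorem decomp_le (k : ℤ) : decomp Γ k ≤ levelSpace Γ k := by
  intro f hf
  obtain ⟨g, hg, h, hh, rfl⟩ := (mem_decomp_iff Γ).mp hf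
  refine Submodule.add_mem _ ?_ ?_
  · simpa using levelOne_mul_mem Γ E4_mem hg
  · simpa using levelOne_mul_mem Γ E6_mem hh

/-- **Generators in weight `k`**: a linearly independent finite family in `A_k` spanning a
complement of `E₄ A_{k-4} + E₆ A_{k-6}` (a lift of a basis of `A_k / (E₄, E₆)A`). [folklore] -/
theorem exists_generators (k : ℤ) : ∃ (n : ℕ) (b : Fin n → (ℍ → ℂ)),
    (∀ i, b i ∈ levelSpace Γ k) ∧ LinearIndependent ℂ b ∧
    Disjoint (Submodule.span ℂ (Set.range b)) (decomp Γ k) ∧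
    levelSpace Γ k ≤ decomp Γ k ⊔ Submodule.span ℂ (Set.range b) := by
  obtain ⟨Q₀, hQ₀⟩ := (decomp Γ k).exists_isCompl
  -- the complement inside `A_k`
  let Q : Submodule ℂ (ℍ → ℂ) := Q₀ ⊓ levelSpace Γ k
  haveI : FiniteDimensional ℂ Q := Submodule.finiteDimensional_inf_right _ _
  let b₀ : Module.Basis (Fin (Module.finrank ℂ Q)) ℂ Q := Module.finBasis ℂ Q
  have hspan : Submodule.span ℂ (Set.range (Q.subtype ∘ b₀)) = Q := by
    rw [Set.range_comp, ← Submodule.map_span, b₀.span_eq, Submodule.map_top, Submodule.range_subtype]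
  refine ⟨_, Q.subtype ∘ b₀, fun i ↦ (b₀ i).2.2, ?_, ?_, ?_⟩
  · exact b₀.linearIndependent.map' Q.subtype (Submodule.ker_subtype Q)
  · rw [hspan]
    exact (hQ₀.symm.disjoint).mono_left inf_le_left
  · intro v hv
    have htop : v ∈ decomp Γ k ⊔ Q₀ := by
      rw [hQ₀.sup_eq_top]
      trivial
    obtain ⟨d, hd, q, hq, rfl⟩ := Submodule.mem_sup.mp htop
    have hqV : q ∈ levelSpace Γ k := by
      have : d + q - d ∈ levelSpace Γ k := Submodule.sub_mem _ hv (decomp_le Γ k hd)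
      simpa using this
    rw [hspan]
    exact Submodule.add_mem_sup hd ⟨hq, hqV⟩

/-- The number of generators of weight `k` (for `k : ℕ`). [folklore] -/
def numGen (k : ℕ) : ℕ := Classical.choose (exists_generators Γ k)

/-- The generators of weight `k`. [folklore] -/
def gen (k : ℕ) : Fin (numGen Γ k) → (ℍ → ℂ) :=
  Classical.choose (Classical.choose_spec (exists_generators Γ k))

/-- Specification of the generators. [folklore] -/
theorem gen_spec (k : ℕ) :
    (∀ i, gen Γ k i ∈ levelSpace Γ k) ∧ LinearIndependent ℂ (gen Γ k) ∧
    Disjoint (Submodule.span ℂ (Set.range (gen Γ k))) (decomp Γ k) ∧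
    levelSpace Γ k ≤ decomp Γ k ⊔ Submodule.span ℂ (Set.range (gen Γ k)) :=
  Classical.choose_spec (Classical.choose_spec (exists_generators Γ k))

/-- The index type of all generators: pairs (weight, index). [folklore] -/
abbrev GenIndex : Type := Σ k : ℕ, Fin (numGen Γ k)

/-- The weight of a generator. [folklore] -/
def GenIndex.wt (j : GenIndex Γ) : ℤ := (j.1 : ℤ)

/-- The generator as a function. [folklore] -/
def GenIndex.fn (j : GenIndex Γ) : ℍ → ℂ := gen Γ j.1 j.2

/-- The (finite) set of generators of weight `≤ m`. [folklore] -/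
def genBelow (m : ℕ) : Finset (GenIndex Γ) :=
  (Finset.range (m + 1)).sigma fun _ ↦ Finset.univ

/-- Membership in `genBelow`. [folklore] -/
@[simp] theorem mem_genBelow {m : ℕ} {j : GenIndex Γ} : j ∈ genBelow Γ m ↔ j.1 ≤ m := by
  simp [genBelow]

/-- Monotonicity of `genBelow`. [folklore] -/
theorem genBelow_mono {m m' : ℕ} (h : m ≤ m') : genBelow Γ m ⊆ genBelow Γ m' := fun j hj ↦ by
  rw [mem_genBelow] at hj ⊢
  omega

/-- A generator lies in its form space. [folklore] -/
theorem GenIndex.fn_mem (j : GenIndex Γ) : j.fn ∈ levelSpace Γ j.wt := (gen_spec Γ j.1).1 j.2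

/-- Weights of generators are nonnegative. [folklore] -/
theorem GenIndex.wt_nonneg (j : GenIndex Γ) : 0 ≤ j.wt := Int.natCast_nonneg _

/-- Coefficients of negative weight vanish: if `p ∈ R_{m - wt j}` and `m < wt j` then `p = 0`.
[folklore] -/
theorem coeff_eq_zero_of_lt {m : ℤ} {j : GenIndex Γ} {p : ℍ → ℂ}
    (hp : p ∈ levelOneSpace (m - j.wt)) (h : m < j.wt) : p = 0 := by
  have : levelOneSpace (m - j.wt) = ⊥ := formSpace_eq_bot_of_neg (by omega)
  rw [this] at hp
  exact hp

/-- Sums `∑ p_j F_j` with `p_j ∈ R_{m - k_j}` lie in `A_m`. [folklore] -/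
theorem sum_mul_fn_mem {m : ℤ} (s : Finset (GenIndex Γ)) {p : GenIndex Γ → ℍ → ℂ}
    (hp : ∀ j, p j ∈ levelOneSpace (m - j.wt)) : ∑ j ∈ s, p j * j.fn ∈ levelSpace Γ m := by
  refine Submodule.sum_mem _ fun j _ ↦ ?_
  have := levelOne_mul_mem Γ (hp j) (GenIndex.fn_mem Γ j)
  rwa [sub_add_cancel] at this

/-- **Transport of sums**: if `p_j ∈ R_{m - k_j}` then the sum over generators of weight `≤ m'`
equals the sum over generators of weight `≤ m.toNat` for any `m' ≥ m.toNat` (the extra terms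
vanish). [folklore] -/
theorem sum_genBelow_eq {m : ℤ} {m' : ℕ} (hm : m.toNat ≤ m') {p : GenIndex Γ → ℍ → ℂ}
    (hp : ∀ j, p j ∈ levelOneSpace (m - j.wt)) :
    ∑ j ∈ genBelow Γ m', p j * j.fn = ∑ j ∈ genBelow Γ m.toNat, p j * j.fn := by
  symm
  apply Finset.sum_subset (genBelow_mono Γ hm)
  intro j hj hj'
  rw [mem_genBelow] at hj hj'
  have : m < j.wt := by
    simp only [GenIndex.wt]
    omega
  rw [coeff_eq_zero_of_lt Γ (hp j) this, zero_mul]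

/-- **Spanning**: every `f ∈ A_m` is `∑_j p_j F_j` over the generators of weight `≤ m`, with
level-one coefficients `p_j ∈ R_{m - k_j}` (induction on the weight, using
`A_k ⊆ E₄A_{k-4} + E₆A_{k-6} + ⟨generators of weight k⟩`). [folklore] -/
theorem exists_coeffs (m : ℤ) {f : ℍ → ℂ} (hf : f ∈ levelSpace Γ m) :
    ∃ p : GenIndex Γ → ℍ → ℂ, (∀ j, p j ∈ levelOneSpace (m - j.wt)) ∧
      f = ∑ j ∈ genBelow Γ m.toNat, p j * j.fn := by
  induction' hn : m.toNat using Nat.strong_induction_on with n ih generalizing m f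
  rcases lt_or_ge m 0 with hneg | hnonneg
  · have hf0 : f = 0 := by
      have : levelSpace Γ m = ⊥ := formSpace_eq_bot_of_neg hneg
      rw [this] at hf
      exact hf
    exact ⟨0, fun j ↦ Submodule.zero_mem _, by simp [hf0]⟩
  obtain rfl : m = n := by omega
  -- the induction hypothesis for all integer weights `< n` (trivial below `0`)
  have ih' : ∀ m' : ℤ, m' < n → ∀ {f : ℍ → ℂ}, f ∈ levelSpace Γ m' →
      ∃ p : GenIndex Γ → ℍ → ℂ, (∀ j, p j ∈ levelOneSpace (m' - j.wt)) ∧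
        f = ∑ j ∈ genBelow Γ m'.toNat, p j * j.fn := by
    intro m' hm' f hf
    rcases lt_or_ge m' 0 with hneg | hnn
    · have hf0 : f = 0 := by
        have : levelSpace Γ m' = ⊥ := formSpace_eq_bot_of_neg hneg
        rw [this] at hf
        exact hf
      exact ⟨0, fun j ↦ Submodule.zero_mem _, by simp [hf0]⟩
    · exact ih m'.toNat (by omega) m' hf rfl
  -- decompose `f` in weight `n`
  obtain ⟨hmem, -, -, hle⟩ := gen_spec Γ n
  obtain ⟨d, hd, v, hv, rfl⟩ := Submodule.mem_sup.mp (hle hf)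
  obtain ⟨g, hg, h, hh, rfl⟩ := (mem_decomp_iff Γ).mp hd
  obtain ⟨c, rfl⟩ := (Finsupp.mem_span_range_iff_exists_finsupp.mp hv)
  -- induction hypotheses for `g` and `h`
  obtain ⟨pg, hpg, hgsum⟩ := ih' ((n : ℤ) - 4) (by omega) hg
  obtain ⟨ph, hph, hhsum⟩ := ih' ((n : ℤ) - 6) (by omega) hh
  classical
  refine ⟨fun j ↦ ⇑E₄ * pg j + ⇑E₆ * ph j +
      (if hj : j.1 = n then c (Fin.cast (by rw [hj]) j.2) else 0) • 1, fun j ↦ ?_, ?_⟩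
  · refine Submodule.add_mem _ (Submodule.add_mem _ ?_ ?_) ?_
    · have := mul_mem_formSpace E4_mem (hpg j)
      rwa [show (4 : ℤ) + ((n : ℤ) - 4 - j.wt) = n - j.wt by ring] at this
    · have := mul_mem_formSpace E6_mem (hph j)
      rwa [show (6 : ℤ) + ((n : ℤ) - 6 - j.wt) = n - j.wt by ring] at this
    · split_ifs with hj
      · have h0 : (n : ℤ) - j.wt = 0 := by simp [GenIndex.wt, hj]
        rw [h0]
        exact Submodule.smul_mem _ _ ⟨1, ModularForm.one_coe_eq_one⟩
      · simp
  · simp only [add_mul, Finset.sum_add_distrib]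
    have e1 : ∑ j ∈ genBelow Γ n, ⇑E₄ * pg j * j.fn = ⇑E₄ * g := by
      rw [hgsum, ← sum_genBelow_eq Γ (m := (n : ℤ) - 4) (m' := n) (by omega) hpg, Finset.mul_sum]
      simp only [mul_assoc]
    have e2 : ∑ j ∈ genBelow Γ n, ⇑E₆ * ph j * j.fn = ⇑E₆ * h := by
      rw [hhsum, ← sum_genBelow_eq Γ (m := (n : ℤ) - 6) (m' := n) (by omega) hph, Finset.mul_sum]
      simp only [mul_assoc]
    rw [e1, e2]
    congr 1
    -- the generator part
    rw [genBelow, Finset.sum_sigma, Finset.sum_eq_single_of_mem n (by simp) (fun k _ hk ↦ ?_)]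
    · simp only [Fin.cast_eq_self, Finsupp.sum]
      rw [Finset.sum_subset (Finset.subset_univ c.support) (fun i _ hi ↦ by
        simp [Finsupp.notMem_support_iff.mp hi])]
      refine Finset.sum_congr rfl fun i _ ↦ ?_
      simp [GenIndex.fn, Pi.smul_def, smul_eq_mul]
      rfl
    · exact Finset.sum_eq_zero fun i _ ↦ by simp [hk]

/-- The generators of weight `n` are linearly independent over `ℂ`, in the form needed below:
a vanishing combination `∑_{j, wt j ≤ n} c_j F_j = 0` supported on `wt j = n` has `c = 0`.
[folklore] -/
theorem consts_eq_zero (n : ℕ) {c : GenIndex Γ → ℂ} (hc : ∀ j, j.1 ≠ n → c j = 0)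
    (h0 : ∑ j ∈ genBelow Γ n, c j • j.fn = 0) : ∀ j, c j = 0 := by
  have hsum : ∑ j ∈ genBelow Γ n, c j • j.fn = ∑ i : Fin (numGen Γ n), c ⟨n, i⟩ • gen Γ n i := by
    rw [genBelow, Finset.sum_sigma, Finset.sum_eq_single_of_mem n (by simp) (fun k _ hk ↦ ?_)]
    · rfl
    · exact Finset.sum_eq_zero fun i _ ↦ by simp [hc ⟨k, i⟩ hk]
  rw [hsum] at h0
  have hli := (gen_spec Γ n).2.1
  have := Fintype.linearIndependent_iff.mp hli (fun i ↦ c ⟨n, i⟩) h0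
  intro j
  by_cases hj : j.1 = n
  · obtain ⟨k, i⟩ := j
    subst hj
    exact this i
  · exact hc j hj

/-- **Independence over `M(SL₂(ℤ))`**: a relation `∑_j p_j F_j = 0` with level-one coefficients
`p_j ∈ R_{m - k_j}` is trivial. Proof (graded Nakayama by hand): write `p_j = E₄a_j + E₆b_j + c_j`
(`c_j` constants, present only for `k_j = m`); the constants vanish because the generators of
weight `m` span a complement of `E₄A_{m-4} + E₆A_{m-6}`; then `E₄X = -E₆Y` with
`X = ∑ a_jF_j`, `Y = ∑ b_jF_j`, so `X = E₆G` by the division lemma, and expanding `G` in the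
generators (spanning in weight `m - 10`) the induction hypothesis in weights `m - 4` and `m - 6`
gives `a_j = E₆q_j`, `b_j = -E₄q_j`, whence `p_j = 0`. [folklore] -/
theorem coeffs_eq_zero (m : ℤ) (p : GenIndex Γ → ℍ → ℂ)
    (hp : ∀ j, p j ∈ levelOneSpace (m - j.wt))
    (h0 : ∑ j ∈ genBelow Γ m.toNat, p j * j.fn = 0) : ∀ j, p j = 0 := by
  induction' hn : m.toNat using Nat.strong_induction_on with n ih generalizing m p
  -- negative weight: all coefficients vanish for weight reasons
  have hnegcase : ∀ (m' : ℤ), m' < 0 → ∀ (p' : GenIndex Γ → ℍ → ℂ),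
      (∀ j, p' j ∈ levelOneSpace (m' - j.wt)) → ∀ j, p' j = 0 := fun m' hm' p' hp' j ↦
    coeff_eq_zero_of_lt Γ (hp' j) (lt_of_lt_of_le hm' (GenIndex.wt_nonneg Γ j))
  rcases lt_or_ge m 0 with hneg | hnonneg
  · exact hnegcase m hneg p hp
  obtain rfl : m = n := by omega
  have ih' : ∀ m' : ℤ, m' < n → ∀ (p' : GenIndex Γ → ℍ → ℂ),
      (∀ j, p' j ∈ levelOneSpace (m' - j.wt)) →
      ∑ j ∈ genBelow Γ m'.toNat, p' j * j.fn = 0 → ∀ j, p' j = 0 := by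
    intro m' hm' p' hp' h0'
    rcases lt_or_ge m' 0 with hneg | hnn
    · exact hnegcase m' hneg p' hp'
    · exact ih m'.toNat (by omega) m' p' hp' h0' rfl
  -- Step 1: decompose the coefficients
  have hdec : ∀ j : GenIndex Γ, ∃ a b : ℍ → ℂ, ∃ c : ℂ,
      a ∈ levelOneSpace ((n : ℤ) - 4 - j.wt) ∧ b ∈ levelOneSpace ((n : ℤ) - 6 - j.wt) ∧
      (j.1 ≠ n → c = 0) ∧ p j = ⇑E₄ * a + ⇑E₆ * b + c • 1 := by
    intro j
    rcases lt_trichotomy (j.1 : ℤ) n with hlt | heq | hgt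
    · have hw : (n : ℤ) - j.wt ≠ 0 := by simp only [GenIndex.wt]; omega
      obtain ⟨_, ⟨a, ha, rfl⟩, _, ⟨b, hb, rfl⟩, hab⟩ :=
        Submodule.mem_sup.mp (levelOneSpace_le_sup hw (hp j))
      refine ⟨a, b, 0, ?_, ?_, fun _ ↦ rfl, ?_⟩
      · rwa [show (n : ℤ) - j.wt - 4 = n - 4 - j.wt by ring] at ha
      · rwa [show (n : ℤ) - j.wt - 6 = n - 6 - j.wt by ring] at hb
      · rw [← hab]
        simp [LinearMap.mulLeft_apply]
    · have h0w : (n : ℤ) - j.wt = 0 := by simp only [GenIndex.wt]; omega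
      have hpj := hp j
      rw [h0w] at hpj
      obtain ⟨F, hF⟩ := hpj
      obtain ⟨c, hc⟩ := ModularForm.eq_const_of_weight_zero F
      refine ⟨0, 0, c, Submodule.zero_mem _, Submodule.zero_mem _, fun h ↦ ?_, ?_⟩
      · exact absurd (by exact_mod_cast heq) h
      · rw [← hF, hc]
        funext z
        simp
    · have : p j = 0 := coeff_eq_zero_of_lt Γ (hp j) (by simp only [GenIndex.wt]; omega)
      exact ⟨0, 0, 0, Submodule.zero_mem _, Submodule.zero_mem _, fun _ ↦ rfl, by simp [this]⟩
  choose a b c ha hb hc hpabc using hdec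
  -- Step 2: the constants vanish
  set X : ℍ → ℂ := ∑ j ∈ genBelow Γ n, a j * j.fn with hX
  set Y : ℍ → ℂ := ∑ j ∈ genBelow Γ n, b j * j.fn with hY
  set Z : ℍ → ℂ := ∑ j ∈ genBelow Γ n, c j • j.fn with hZ
  have hXmem : X ∈ levelSpace Γ ((n : ℤ) - 4) := sum_mul_fn_mem Γ _ ha
  have hYmem : Y ∈ levelSpace Γ ((n : ℤ) - 6) := sum_mul_fn_mem Γ _ hb
  have hrel : ⇑E₄ * X + ⇑E₆ * Y + Z = 0 := by
    rw [← h0, Int.toNat_natCast, hX, hY, hZ, Finset.mul_sum, Finset.mul_sum,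
      ← Finset.sum_add_distrib, ← Finset.sum_add_distrib]
    refine Finset.sum_congr rfl fun j _ ↦ ?_
    rw [hpabc j]
    simp only [add_mul, mul_assoc, smul_one_mul]
  have hZspan : Z ∈ Submodule.span ℂ (Set.range (gen Γ n)) := by
    refine Submodule.sum_mem _ fun j _ ↦ ?_
    by_cases hj : j.1 = n
    · refine Submodule.smul_mem _ _ (Submodule.subset_span ?_)
      obtain ⟨k, i⟩ := j
      subst hj
      exact ⟨i, rfl⟩
    · simp [hc j hj]
  have hZdec : Z ∈ decomp Γ n := by
    have : Z = -(⇑E₄ * X + ⇑E₆ * Y) := by rw [← add_eq_zero_iff_eq_neg', hrel]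
    rw [this]
    exact Submodule.neg_mem _ ((mem_decomp_iff Γ).mpr ⟨X, hXmem, Y, hYmem, rfl⟩)
  have hZ0 : Z = 0 := Submodule.disjoint_def.mp (gen_spec Γ n).2.2.1 Z hZspan hZdec
  have hc0 : ∀ j, c j = 0 := consts_eq_zero Γ n hc (hZ ▸ hZ0)
  -- Step 3: `E₄ X = E₆ (-Y)`, divide
  have hrel' : ⇑E₄ * X = ⇑E₆ * (-Y) := by
    rw [hZ0, add_zero] at hrel
    rw [mul_neg, ← add_eq_zero_iff_eq_neg, hrel]
  obtain ⟨G, hG, hXG⟩ := exists_eq_E6_mul_of_E4_mul_eq (level_le_SL Γ) hXmem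
    (by rw [show (n : ℤ) - 4 - 2 = n - 6 by ring]; exact Submodule.neg_mem _ hYmem) hrel'
  rw [show (n : ℤ) - 4 - 6 = n - 10 by ring] at hG
  obtain ⟨q, hq, hGsum⟩ := exists_coeffs Γ ((n : ℤ) - 10) hG
  have hGsum' : G = ∑ j ∈ genBelow Γ n, q j * j.fn := by
    rw [hGsum, sum_genBelow_eq Γ (m := (n : ℤ) - 10) (m' := n) (by omega) hq]
  -- relation in weight `n - 4`: `a_j = E₆ q_j`
  have haq : ∀ j, a j = ⇑E₆ * q j := by
    have hcoef : ∀ j, a j - ⇑E₆ * q j ∈ levelOneSpace ((n : ℤ) - 4 - j.wt) := fun j ↦ by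
      refine Submodule.sub_mem _ (ha j) ?_
      have := mul_mem_formSpace E6_mem (hq j)
      rwa [show (6 : ℤ) + ((n : ℤ) - 10 - j.wt) = n - 4 - j.wt by ring] at this
    have hsum0 : ∑ j ∈ genBelow Γ ((n : ℤ) - 4).toNat, (a j - ⇑E₆ * q j) * j.fn = 0 := by
      rw [← sum_genBelow_eq Γ (m := (n : ℤ) - 4) (m' := n) (by omega) hcoef]
      simp only [sub_mul, Finset.sum_sub_distrib, mul_assoc, ← Finset.mul_sum]
      rw [← hGsum', ← hX, hXG, sub_self]
    intro j
    exact sub_eq_zero.mp (ih' ((n : ℤ) - 4) (by omega) _ hcoef hsum0 j)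
  -- Step 4: `E₄ G + Y = 0`, relation in weight `n - 6`: `b_j = -E₄ q_j`
  have hE4GY : ⇑E₄ * G + Y = 0 := by
    have h1 : ⇑E₆ * (⇑E₄ * G + Y) = ⇑E₆ * 0 := by
      rw [mul_zero, mul_add, ← mul_assoc, mul_comm (⇑E₆) (⇑E₄), mul_assoc, ← hXG]
      rw [hZ0, add_zero] at hrel
      exact hrel
    have hGmem : G ∈ levelSpace Γ ((n : ℤ) - 10) := hG
    refine E6_mul_left_cancel ?_ continuous_const h1
    exact ((mdifferentiable_of_mem_formSpace (levelOne_mul_mem Γ E4_mem hGmem)).continuous).add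
      (mdifferentiable_of_mem_formSpace hYmem).continuous
  have hbq : ∀ j, b j = -(⇑E₄ * q j) := by
    have hcoef : ∀ j, ⇑E₄ * q j + b j ∈ levelOneSpace ((n : ℤ) - 6 - j.wt) := fun j ↦ by
      refine Submodule.add_mem _ ?_ (hb j)
      have := mul_mem_formSpace E4_mem (hq j)
      rwa [show (4 : ℤ) + ((n : ℤ) - 10 - j.wt) = n - 6 - j.wt by ring] at this
    have hsum0 : ∑ j ∈ genBelow Γ ((n : ℤ) - 6).toNat, (⇑E₄ * q j + b j) * j.fn = 0 := by
      rw [← sum_genBelow_eq Γ (m := (n : ℤ) - 6) (m' := n) (by omega) hcoef]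
      simp only [add_mul, Finset.sum_add_distrib, mul_assoc, ← Finset.mul_sum]
      rw [← hGsum', ← hY, hE4GY]
    intro j
    exact eq_neg_of_add_eq_zero_right (ih' ((n : ℤ) - 6) (by omega) _ hcoef hsum0 j)
  -- Step 5
  intro j
  rw [hpabc j, haq j, hbq j, hc0 j]
  simp only [zero_smul, add_zero]
  ring

/-! ### Counting: at most `μ` generators -/

/-- There are no generators in odd weight when `-1 ∈ Γ` (`A_k = 0`). [folklore] -/
theorem numGen_eq_zero_of_odd (hneg : -1 ∈ Γ) {k : ℕ} (hk : Odd k) : numGen Γ k = 0 := by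
  by_contra h
  have hli := (gen_spec Γ k).2.1
  have hmem := (gen_spec Γ k).1 ⟨0, Nat.pos_of_ne_zero h⟩
  rw [levelSpace_eq_bot_of_odd Γ hneg (by exact_mod_cast hk), Submodule.mem_bot] at hmem
  exact hli.ne_zero ⟨0, Nat.pos_of_ne_zero h⟩ hmem

/-- Weights of generators are even when `-1 ∈ Γ`. [folklore] -/
theorem GenIndex.even_fst (hneg : -1 ∈ Γ) (j : GenIndex Γ) : Even j.1 := by
  by_contra h
  rw [Nat.not_even_iff_odd] at h
  have := numGen_eq_zero_of_odd Γ hneg h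
  exact (Nat.pos_iff_ne_zero.mp (this ▸ j.2.pos : 0 < 0)).elim rfl |>.elim

/-- **The key inequality**: for all `B, L`, `#(generators of weight ≤ B) · L ≤ Lμ + Bμ + 1`, from
the injection `⊕_{j} R_{M - k_j} ↪ A_M` (`M = 12L + 2B`, independence) and Sturm's bound
`dim A_M ≤ Mμ/12 + 1` against `dim R_w ≥ ⌊w/12⌋`. [folklore] -/
theorem card_genBelow_mul_le (hneg : -1 ∈ Γ) (B L : ℕ) :
    (genBelow Γ B).card * L ≤ L * Γ.index + B * Γ.index + 1 := by
  classical
  set M : ℕ := 12 * L + 2 * B with hM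
  set s := genBelow Γ B with hs
  -- the combination map
  let Ψ : (Π j : s, levelOneSpace ((M : ℤ) - (j : GenIndex Γ).wt)) →ₗ[ℂ] (ℍ → ℂ) :=
    { toFun := fun p ↦ ∑ j : s, ((p j : ℍ → ℂ)) * (j : GenIndex Γ).fn
      map_add' := fun p p' ↦ by
        simp only [Pi.add_apply, Submodule.coe_add, add_mul, Finset.sum_add_distrib]
      map_smul' := fun c p ↦ by
        simp only [Pi.smul_apply, Submodule.coe_smul, RingHom.id_apply, Finset.smul_sum,
          smul_mul_assoc] }
  have hΨmem : ∀ p, Ψ p ∈ levelSpace Γ M := fun p ↦ by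
    refine Submodule.sum_mem _ fun j _ ↦ ?_
    have := levelOne_mul_mem Γ (p j).2 (GenIndex.fn_mem Γ (j : GenIndex Γ))
    rwa [sub_add_cancel] at this
  have hΨinj : Function.Injective (Ψ.codRestrict _ hΨmem) := by
    rw [injective_iff_map_eq_zero]
    intro p hp0
    have hsum0 : ∑ j : s, ((p j : ℍ → ℂ)) * (j : GenIndex Γ).fn = 0 :=
      congrArg Subtype.val hp0
    -- extend `p` by zero
    let P : GenIndex Γ → ℍ → ℂ := fun j ↦ if h : j ∈ s then (p ⟨j, h⟩ : ℍ → ℂ) else 0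
    have hP : ∀ j, P j ∈ levelOneSpace ((M : ℤ) - j.wt) := fun j ↦ by
      by_cases h : j ∈ s
      · simp only [P, h, dif_pos]
        exact (p ⟨j, h⟩).2
      · simp only [P, h, dif_neg, not_false_eq_true]
        exact Submodule.zero_mem _
    have hPsum : ∑ j ∈ genBelow Γ (M : ℤ).toNat, P j * j.fn = 0 := by
      rw [Int.toNat_natCast, ← Finset.sum_subset (genBelow_mono Γ (show B ≤ M by omega))
        (fun j _ hj ↦ by
          have : ¬ j.1 ≤ B := fun h ↦ hj ((mem_genBelow Γ).mpr h)
          simp [P, hs, this])]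
      rw [← hsum0, ← Finset.sum_coe_sort s]
      refine Finset.sum_congr rfl fun j _ ↦ ?_
      simp [P, j.2]
    have hP0 := coeffs_eq_zero Γ (M : ℤ) P hP hPsum
    funext j
    apply Subtype.ext
    have := hP0 j
    simp only [P, j.2, dif_pos] at this
    simpa using this
  -- dimension count
  have hdom : s.card * L ≤ Module.finrank ℂ (Π j : s, levelOneSpace ((M : ℤ) - (j : GenIndex Γ).wt)) := by
    have hcard : s.card * L = ∑ _i : s, L := by
      simp [Finset.sum_const]
    rw [Module.finrank_pi_fintype, hcard]
    refine Finset.sum_le_sum fun j _ ↦ ?_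
    have hjB : (j : GenIndex Γ).1 ≤ B := (mem_genBelow Γ).mp j.2
    obtain ⟨r, hr⟩ := GenIndex.even_fst Γ hneg j
    have hw : ((M : ℤ) - (j : GenIndex Γ).wt) = ((M - (j : GenIndex Γ).1 : ℕ) : ℤ) := by
      simp only [GenIndex.wt]
      omega
    rw [hw]
    refine le_trans ?_ (le_finrank_levelOneSpace ⟨6 * L + B - r, by omega⟩)
    omega
  have hcod : Module.finrank ℂ (levelSpace Γ M) ≤ L * Γ.index + B * Γ.index + 1 := by
    refine (finrank_levelSpace_le Γ M).trans ?_
    have : ((M : ℤ) * Γ.index).toNat = M * Γ.index := by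
      rw [show ((M : ℤ) * Γ.index) = ((M * Γ.index : ℕ) : ℤ) by push_cast; ring]
      exact Int.toNat_natCast _
    rw [this, hM]
    have h1 : (12 * L + 2 * B) * Γ.index / 12 ≤ L * Γ.index + B * Γ.index := by
      apply Nat.div_le_of_le_mul
      nlinarith
    omega
  exact hdom.trans ((LinearMap.finrank_le_finrank_of_injective hΨinj).trans hcod)

/-- **At most `μ = [SL₂(ℤ) : Γ]` generators** of weight `≤ B`, for every `B`. [folklore] -/
theorem card_genBelow_le (hneg : -1 ∈ Γ) (B : ℕ) : (genBelow Γ B).card ≤ Γ.index := by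
  by_contra h
  push Not at h
  have key := card_genBelow_mul_le Γ hneg B (B * Γ.index + 2)
  set μ := Γ.index
  set L := B * μ + 2 with hL
  have h1 : (μ + 1) * L ≤ L * μ + B * μ + 1 := (Nat.mul_le_mul_right L h).trans key
  rw [Nat.succ_mul, mul_comm L μ] at h1
  omega

/-- The generators have bounded weight: there are finitely many. [folklore] -/
theorem exists_fst_le (hneg : -1 ∈ Γ) : ∃ K₀ : ℕ, ∀ j : GenIndex Γ, j.1 ≤ K₀ := by
  classical
  set S : Set ℕ := {k | numGen Γ k ≠ 0} with hS
  have hSfin : S.Finite := by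
    by_contra hinf
    obtain ⟨T, hTS, hTcard⟩ := Set.Infinite.exists_subset_card_eq hinf (Γ.index + 1)
    set B := T.sup id
    have h1 : T.card ≤ ∑ k ∈ T, numGen Γ k := by
      rw [Finset.card_eq_sum_ones]
      exact Finset.sum_le_sum fun k hk ↦ Nat.one_le_iff_ne_zero.mpr (hTS hk)
    have h2 : ∑ k ∈ T, numGen Γ k ≤ (genBelow Γ B).card := by
      rw [genBelow, Finset.card_sigma]
      simp only [Finset.card_univ, Fintype.card_fin]
      refine Finset.sum_le_sum_of_subset fun k hk ↦ ?_
      exact Finset.mem_range.mpr (Nat.lt_succ_of_le (Finset.le_sup (f := id) hk))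
    have h3 := card_genBelow_le Γ hneg B
    omega
  refine ⟨hSfin.toFinset.sup id, fun j ↦ ?_⟩
  have hj : j.1 ∈ hSfin.toFinset := by
    rw [Set.Finite.mem_toFinset]
    exact Nat.pos_iff_ne_zero.mp j.2.pos
  exact Finset.le_sup (f := id) hj

/-! ### The free basis -/

/-- **A level-one basis of `M(Γ)`**: a finite family `F_i ∈ M_{k_i}(Γ)` such that every
`f ∈ M_m(Γ)` is uniquely `∑_i p_i F_i` with `p_i ∈ M_{m - k_i}(SL₂(ℤ))`; i.e. `(F_i)` is a
basis of the `M(SL₂(ℤ)) = ℂ[E₄,E₆]`-module `M(Γ) = ⊕_m M_m(Γ)`, homogeneous of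
weights `k_i`. [cite: Gannon2014, Thm. 3.4] -/
structure IsLevelBasis {r : ℕ} (wt : Fin r → ℤ) (F : Fin r → ℍ → ℂ) : Prop where
  mem : ∀ i, F i ∈ levelSpace Γ (wt i)
  span : ∀ (m : ℤ) (f : ℍ → ℂ), f ∈ levelSpace Γ m →
    ∃ p : Fin r → ℍ → ℂ, (∀ i, p i ∈ levelOneSpace (m - wt i)) ∧ f = ∑ i, p i * F i
  indep : ∀ (m : ℤ) (p : Fin r → ℍ → ℂ), (∀ i, p i ∈ levelOneSpace (m - wt i)) →
    ∑ i, p i * F i = 0 → ∀ i, p i = 0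

/-- **`M(Γ)` is a free `M(SL₂(ℤ))`-module on at most `μ = [SL₂(ℤ) : Γ]` homogeneous
generators of even nonnegative weights** (the Ind-from-`Γ` case of the Marks–Mason free-module
theorem, `H(ρ)` free of rank `dim ρ` over `ℂ[E₄, E₆]`; the rank is exactly `μ`, the lower bound
being supplied separately). [cite: Gannon2014, Thm. 3.4] -/
theorem exists_isLevelBasis (hneg : -1 ∈ Γ) : ∃ (r : ℕ) (wt : Fin r → ℤ) (F : Fin r → ℍ → ℂ),
    IsLevelBasis Γ wt F ∧ r ≤ Γ.index ∧ ∀ i, 0 ≤ wt i ∧ Even (wt i) := by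
  classical
  obtain ⟨K₀, hK₀⟩ := exists_fst_le Γ hneg
  set s := genBelow Γ K₀ with hs
  have hall : ∀ m, K₀ ≤ m → genBelow Γ m = s := fun m hm ↦ by
    ext j
    simp only [mem_genBelow, hs]
    exact ⟨fun _ ↦ hK₀ j, fun _ ↦ (hK₀ j).trans hm⟩
  -- sums over `genBelow Γ m.toNat` are sums over `s`
  have hsum : ∀ (m : ℤ) (p : GenIndex Γ → ℍ → ℂ), (∀ j, p j ∈ levelOneSpace (m - j.wt)) →
      ∑ j ∈ genBelow Γ m.toNat, p j * j.fn = ∑ j ∈ s, p j * j.fn := by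
    intro m p hp
    rcases le_or_gt K₀ m.toNat with h | h
    · rw [hall _ h]
    · exact (sum_genBelow_eq Γ h.le hp).symm
  set r := s.card
  let e : Fin r ≃ s := s.equivFin.symm
  refine ⟨r, fun i ↦ (e i : GenIndex Γ).wt, fun i ↦ (e i : GenIndex Γ).fn, ⟨fun i ↦ ?_, ?_, ?_⟩,
    card_genBelow_le Γ hneg K₀, fun i ↦ ⟨GenIndex.wt_nonneg Γ _, ?_⟩⟩
  · exact GenIndex.fn_mem Γ _
  · intro m f hf
    obtain ⟨p, hp, hf⟩ := exists_coeffs Γ m hf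
    refine ⟨fun i ↦ p (e i), fun i ↦ hp _, ?_⟩
    rw [hf, hsum m p hp, ← Finset.sum_coe_sort s, ← e.sum_comp]
  · intro m p hp h0 i
    let P : GenIndex Γ → ℍ → ℂ := fun j ↦ if h : j ∈ s then p (e.symm ⟨j, h⟩) else 0
    have hP : ∀ j, P j ∈ levelOneSpace (m - j.wt) := fun j ↦ by
      by_cases h : j ∈ s
      · simp only [P, h, dif_pos]
        have := hp (e.symm ⟨j, h⟩)
        simpa using this
      · simp only [P, h, dif_neg, not_false_eq_true]
        exact Submodule.zero_mem _
    have hPsum : ∑ j ∈ genBelow Γ m.toNat, P j * j.fn = 0 := by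
      rw [hsum m P hP, ← Finset.sum_coe_sort s, ← e.sum_comp, ← h0]
      refine Finset.sum_congr rfl fun i _ ↦ ?_
      simp [P, (e i).2]
    have := coeffs_eq_zero Γ m P hP hPsum (e i)
    simpa [P, (e i).2] using this
  · simp only [GenIndex.wt]
    exact_mod_cast GenIndex.even_fst Γ hneg _

end Level

end Level

end Literature.NumberTheory.EllipticCurves.ModularForms
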